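import Literature.NumberTheory.EllipticCurves.LocalRestrictionDegreeTorsion
import Literature.NumberTheory.EllipticCurves.SelmerTorsionInclusion
import Literature.NumberTheory.EllipticCurves.SelmerTorsionTwistRestriction
import Summits.BirchSwinnertonDyer.BirchSwinnertonDyer.Theorems.ErratumRoadFiveShimuraKolyvaginOrderBoundInertShiftCebotarev
import HarnessLib

/-!
# Route `CMKolyvaginAtInertTwo`, crux `CMKolyvaginExactAtInertTwo` (stmt-BirchSwinnertonDyer-24277):
# SUPPLIER of the two-member data, I — the change-of-level maps `[m]_*`, `ι_*` against the local kernels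
# and the twist isomorphism (pure Galois cohomology of `E[n]`)

Seat `bsd-line-cmk2-p1` g18 (cell `bsd-print-cf2`); helper (`--supports stmt-BirchSwinnertonDyer-24277`).
THEOREMS ONLY: no definition, no named fact, no `sorry`; no item is closed; BSD is not proved by this.

The supplier of `D : PairDataM` (KERNEL-STATUS §17.7) builds Kolyvagin's classes over `ℚ` at level `2^M`
as `[2]_*` of the descended classes of level `2^{M+1}` (McCallum 1991 Lemma 4.6: `c_M(n) = [2]_* c_{M+1}(n)`,
tree `torsionH1ZSMul_two_kolyvaginClass`), so that Lemma 4.3 over `ℚ` holds at EVERY finite place including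
the primes of `d_K` (`torsionH1ZSMul_two_mem_selmerLocalKer_of_forall_liesOver`). This file records how
`[m]_* : H¹(K, E[n]) → H¹(K, E[d])` (`torsionH1ZSMul`, `n ∣ d·m`) interacts with the other maps of the
construction:

* `torsionH1OfDvd_torsionH1ZSMul` — **`ι_* ∘ [m]_* = m ·`** on `H¹(K, E[n])` (`ι_*` = `torsionH1OfDvd`, `d ∣ n`);
* `torsionH1ZSMul_mem_selmerLocalKer_iff` — **`[m]_* z` is Selmer at a `K`-field `F` iff `m · z` is**
  (both say `m · (E[·] ↪ E)_* z` dies in `H¹(F, E)`); `torsionH1ZSMul_mem_selmerLocalKer_of_mem`;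
* `torsionH1ZSMul_mem_torsionLocalKer_iff_of_fixed` — at a `K`-field `F` whose Galois group FIXES
  `E(K̄)[n]` (a Kolyvagin prime `λ` of depth `M+1` for `n = 2^{M+1}`, McCallum §4 «`E(K_λ)_{p^M} = E_{p^M}`»):
  **`[m]_* z` vanishes at `F` iff `m · z` does** (`ι_*` is injective there,
  `mem_torsionLocalKer_iff_torsionH1OfDvd_mem`);
* `hPsiKT_torsionH1ZSMul` — **`[m]_*` commutes with the twist isomorphism
  `hPsiKT : H¹(K, E^{(c)}_K[·]) ≃ H¹(K, E_K[·])`** (both are maps of compatible pairs along `id`).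

References: [McCallumLMS1991] §4 Lemma 4.6, Prop. 4.4, §3 (3); [GrossLMS1991] Prop. 6.2, Prop. 9.6;
[SerreGaloisCohomology1997] I.§2.4; [SilvermanAEC2009] X.§4, X.5 Cor. 5.4.
-/

-- single-conjunct summit: `Summit.BirchSwinnertonDyer.BirchSwinnertonDyer.…` repeats the name by design
set_option linter.dupNamespace false
set_option autoImplicit false

noncomputable section

open scoped Classical

universe u

namespace Summit.BirchSwinnertonDyer.BirchSwinnertonDyer.Theorems.KolyvaginPairSupplyTwo

open WeierstrassCurve NumberField Field
open Literature.NumberTheory.EllipticCurves Literature.NumberTheory.GaloisRepresentations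

/-! ## §1 `ι_* ∘ [m]_* = m ·` -/

section Level

variable {K : Type u} [Field K] (W : WeierstrassCurve K) {d n : ℤ}

/-- **`ι_* ([m]_* z) = m · z`** for `z ∈ H¹(K, E[n])`, `d ∣ n ∣ d·m`: the composite
`E[n] →(m·) E[d] ↪ E[n]` is multiplication by `m` on `E[n]`, and `H¹` is additive in the coefficients
(computed on a continuous cocycle, value by value). [cite: McCallumLMS1991, §4 Lemma 4.6]
[cite: SerreGaloisCohomology1997, I.§2.4 (compatible pairs)] -/
theorem torsionH1OfDvd_torsionH1ZSMul (h : d ∣ n) (m : ℤ) (hm : n ∣ d * m) (z : galH1Torsion W n) :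
    torsionH1OfDvd W h (torsionH1ZSMul W m hm z) = m • z := by
  obtain ⟨φ, rfl⟩ := oneCocycleClass_surjective _ z
  unfold torsionH1OfDvd torsionH1ZSMul
  rw [resH1Hom_id_oneCocycleClass, resH1Hom_id_oneCocycleClass]
  have key : contOneCocycles.push (AddSubgroup.inclusion (geomTorsion_le_of_dvd W h)) (fun _ _ ↦ rfl)
      (contOneCocycles.push (geomTorsionZSMul W m hm) (fun σ P ↦ geomTorsionZSMul_smul W m hm σ P) φ) =
      m • φ := by
    apply Subtype.ext
    ext σ : 1
    rfl
  rw [key, ← oneCocycleClassₗ_apply, ← oneCocycleClassₗ_apply, map_zsmul]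

/-! ## §2 `[m]_*` and the Selmer local condition -/

variable (F : Type u) [Field F] [Algebra K F]

/-- **`[m]_* z ∈ selmerLocalKer_F(E[d]) ↔ m · z ∈ selmerLocalKer_F(E[n])`**: the Selmer local condition of
a class is the vanishing of its image in `H¹(F, E)` (`mem_selmerLocalKer_iff_torsionH1ToH1_mem`), and
`(E[d] ↪ E)_* ∘ [m]_* = m · (E[n] ↪ E)_*` (`torsionH1ToH1_torsionH1ZSMul`). [cite: McCallumLMS1991, §4 Lemma 4.3 and Lemma 4.6]
[cite: SilvermanAEC2009, X.§4 (proof of X.4.2)] -/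
theorem torsionH1ZSMul_mem_selmerLocalKer_iff (m : ℤ) (hm : n ∣ d * m) (z : galH1Torsion W n) :
    torsionH1ZSMul W m hm z ∈ selmerLocalKer W F d ↔ m • z ∈ selmerLocalKer W F n := by
  rw [mem_selmerLocalKer_iff_torsionH1ToH1_mem, mem_selmerLocalKer_iff_torsionH1ToH1_mem,
    torsionH1ToH1_torsionH1ZSMul, map_zsmul]

/-- `[m]_*` preserves the Selmer local condition: `z ∈ selmerLocalKer_F(E[n]) ⟹ [m]_* z ∈ selmerLocalKer_F(E[d])`.
[cite: McCallumLMS1991, §4 Lemma 4.3 and Lemma 4.6] -/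
theorem torsionH1ZSMul_mem_selmerLocalKer_of_mem (m : ℤ) (hm : n ∣ d * m) {z : galH1Torsion W n}
    (hz : z ∈ selmerLocalKer W F n) : torsionH1ZSMul W m hm z ∈ selmerLocalKer W F d :=
  (torsionH1ZSMul_mem_selmerLocalKer_iff W F m hm z).mpr (AddSubgroup.zsmul_mem _ hz m)

/-- Multiples: `a · [m]_* z ∈ selmerLocalKer_F(E[d]) ↔ (a m) · z ∈ selmerLocalKer_F(E[n])` (the shape of
the Kolyvagin relation, `a = 2^j`). [cite: McCallumLMS1991, §4 Prop. 4.4 and Lemma 4.6] -/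
theorem zsmul_torsionH1ZSMul_mem_selmerLocalKer_iff (m : ℤ) (hm : n ∣ d * m) (z : galH1Torsion W n)
    (a : ℤ) :
    a • torsionH1ZSMul W m hm z ∈ selmerLocalKer W F d ↔ (a * m) • z ∈ selmerLocalKer W F n := by
  rw [← map_zsmul, torsionH1ZSMul_mem_selmerLocalKer_iff, smul_smul, mul_comm]

end Level

/-! ## §3 `[m]_*` and the strict local kernel at a place whose Galois group fixes `E[n]` -/

section Strict

variable {K : Type u} [Field K] [CharZero K] (W : WeierstrassCurve K) [W.IsElliptic]
  (F : Type u) [Field F] [Algebra K F]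

/-- **`[m]_* z` vanishes at `F` iff `m · z` does**, for `z ∈ H¹(K, E[n])`, `d ∣ n ∣ d·m`, at a `K`-field
`F` whose absolute Galois group fixes `E(K̄)[n]`: `ι_* : H¹(F, E[d]) → H¹(F, E[n])` is injective there
(`mem_torsionLocalKer_iff_torsionH1OfDvd_mem`, bsd-stepL) and `ι_* ∘ [m]_* = m ·`. At `p = 2`: `λ` a
Kolyvagin prime of depth `M+1`, `n = 2^{M+1}`, `d = 2^M`, `m = 2` — McCallum's «`E(K_λ)_{p^M} = E_{p^M}`».
[cite: McCallumLMS1991, §3 (3) and §4 Lemma 4.6] [cite: GrossLMS1991, Prop. 9.6] -/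
theorem torsionH1ZSMul_mem_torsionLocalKer_iff_of_fixed {d n : ℕ} (hdn : d ∣ n) (hd : d ≠ 0) (hn : n ≠ 0)
    (m : ℤ) (hm : ((n : ℕ) : ℤ) ∣ ((d : ℕ) : ℤ) * m)
    (htriv : ∀ (g : absoluteGaloisGroup F) (Q : geomTorsion W ((n : ℕ) : ℤ)), resGal (K := K) F g • Q = Q)
    (z : galH1Torsion W ((n : ℕ) : ℤ)) :
    torsionH1ZSMul W m hm z ∈ W.torsionLocalKer F ((d : ℕ) : ℤ) ↔ m • z ∈ W.torsionLocalKer F ((n : ℕ) : ℤ) := by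
  rw [mem_torsionLocalKer_iff_torsionH1OfDvd_mem W F hdn hd hn htriv,
    torsionH1OfDvd_torsionH1ZSMul W (Int.natCast_dvd_natCast.mpr hdn) m hm z]

/-- Multiples: `a · [m]_* z` vanishes at `F` iff `(a m) · z` does (same hypotheses).
[cite: McCallumLMS1991, §4 Prop. 4.4 and Lemma 4.6] -/
theorem zsmul_torsionH1ZSMul_mem_torsionLocalKer_iff_of_fixed {d n : ℕ} (hdn : d ∣ n) (hd : d ≠ 0)
    (hn : n ≠ 0) (m : ℤ) (hm : ((n : ℕ) : ℤ) ∣ ((d : ℕ) : ℤ) * m)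
    (htriv : ∀ (g : absoluteGaloisGroup F) (Q : geomTorsion W ((n : ℕ) : ℤ)), resGal (K := K) F g • Q = Q)
    (z : galH1Torsion W ((n : ℕ) : ℤ)) (a : ℤ) :
    a • torsionH1ZSMul W m hm z ∈ W.torsionLocalKer F ((d : ℕ) : ℤ) ↔
      (a * m) • z ∈ W.torsionLocalKer F ((n : ℕ) : ℤ) := by
  rw [← map_zsmul, torsionH1ZSMul_mem_torsionLocalKer_iff_of_fixed W F hdn hd hn m hm htriv, smul_smul, mul_comm]

end Strict

/-! ## §4 `[m]_*` commutes with the twist isomorphism `hPsiKT` -/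

section Twist

variable (W : WeierstrassCurve ℚ) (K : Type) [Field K] [NumberField K] {θ : K} {c : ℚ}
  (hθ : θ ∉ Set.range (algebraMap ℚ K)) (hc : θ ^ 2 = algebraMap ℚ K c)

/-- **`hPsiKT ([m]_* y) = [m]_* (hPsiKT y)`** for `y ∈ H¹(K, E^{(c)}_K[n])`, `n ∣ d·m`: both sides are the map of
the compatible pair `(id, P ↦ m·ψ(P))` (`ψ = twistIso` is additive). So the descent identity
`hPsiKT (res y') = c_{M+1}(n)` passes to level `M`: `hPsiKT (res ([2]_* y')) = [2]_* c_{M+1}(n) = c_M(n)`.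
[cite: SilvermanAEC2009, X.5 Cor. 5.4] [cite: McCallumLMS1991, §4 Lemma 4.6] -/
theorem hPsiKT_torsionH1ZSMul {d n : ℤ} (m : ℤ) (hm : n ∣ d * m)
    (y : galH1Torsion ((W.quadraticTwist c).baseChange K) n) :
    hPsiKT W K hθ hc d (torsionH1ZSMul ((W.quadraticTwist c).baseChange K) m hm y) =
      torsionH1ZSMul (W.baseChange K) m hm (hPsiKT W K hθ hc n y) := by
  rw [hPsiKT_apply, hPsiKT_apply]
  unfold torsionH1ZSMul
  rw [resH1Hom_resH1Hom, resH1Hom_resH1Hom]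
  refine congrFun (congrArg DFunLike.coe (resH1Hom_congr rfl ?_ _ _)) y
  ext P
  change ((psiKT W K hθ hc d (geomTorsionZSMul _ m hm P) : geomTorsion (W.baseChange K) d) :
      geomPoints (W.baseChange K)) =
    ((geomTorsionZSMul (W.baseChange K) m hm (psiKT W K hθ hc n P) : geomTorsion (W.baseChange K) d) :
      geomPoints (W.baseChange K))
  rw [coe_psiKT, coe_geomTorsionZSMul, coe_geomTorsionZSMul, coe_psiKT, map_zsmul]

/-- With restriction: `hPsiKT (res ([m]_* y')) = [m]_* (hPsiKT (res y'))` for `y' ∈ H¹(ℚ, E^{(c)}[n])`.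
[cite: SilvermanAEC2009, X.5 Cor. 5.4] [cite: McCallumLMS1991, §4 Lemma 4.6] -/
theorem hPsiKT_resTorsion_torsionH1ZSMul {d n : ℤ} (m : ℤ) (hm : n ∣ d * m)
    (y' : galH1Torsion (W.quadraticTwist c) n) :
    hPsiKT W K hθ hc d (resTorsion (W.quadraticTwist c) K d (torsionH1ZSMul (W.quadraticTwist c) m hm y')) =
      torsionH1ZSMul (W.baseChange K) m hm (hPsiKT W K hθ hc n (resTorsion (W.quadraticTwist c) K n y')) := by
  rw [resTorsion_torsionH1ZSMul, hPsiKT_torsionH1ZSMul]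

end Twist

end Summit.BirchSwinnertonDyer.BirchSwinnertonDyer.Theorems.KolyvaginPairSupplyTwo

end
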